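import Summits.QuantumFields.YangMills.Theorems.BalabanUVNodesN12NearFlatFederbushFibreChart
import Literature.MathematicalPhysics.QuantumFieldTheory.Balaban1983to89.Node00.MultiScaleFibreChartB
import Summits.QuantumFields.YangMills.Theorems.BalabanUVNodesN12FlatChartDerivIterLinB
import HarnessLib

/-!
# BalabanUVNodes ∕ N12 — THE FEDERBUSH FIBRE LETTER IN CHART CURRENCY: from «`DΦ♭(0) w′ = y`» (`Φ♭ = msChart F N K k 𝐁 (M˙1) 1`, n07-w2's canonical — **BOND-DATUM EDITION** (`…N12NearFlatFederbushFibreChartB`, USED DECLARATIONS ONLY)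

The print-datum ([Balaban1984PropagatorsII] (2.3)) (γ) twin of `Summits/…/Theorems/BalabanUVNodesN12NearFlatFederbushFibreChart.lean`: the declarations of the parent whose STATEMENT reads the determining datum
(`iterLin_eq_of_fderiv_msChart_one_eq`) and which N12's junction of record v14ᴸ uses (dag-n12-c g35 probe-2 census `UsedConstsN12RoadTyped2`, THEOREMS block), re-typed over a
BOND-LEVEL datum `𝔅 : BDetSet` (F0a `B15DeterminingSetsB`) and dag-n12-c's bond-datum chart `Node00.msChartB` (✓p774329; `msChart 𝐁 = msChartB (bondsDet 𝐁)` by `rfl`).  GENERATOR twin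
(this seat's `work/g32/gen_thm.py`, block-extracted from the parent's tree bytes): namespace `…N12NearFlatFederbushFibreChartB`, SAME short names, `DetSet ↦ BDetSet`, `AgreeOn 𝐁 ↦ AgreeOnB 𝔅`,
`IsMinimizer ↦ IsMinimizerB`, `bondsOf (𝐁 j) ↦ 𝔅 j`, `msChart ∕ constrCard ∕ constrEnum ∕ ConstrSet ↦ …B`, NODE 00 chart lemmas `…msChart… ↦ …msChartB…`; proofs VERBATIM; the parent's
datum-free declarations REUSED BY NAME (`open`), never copied (private plumbing excepted, №366 R2).  The parent's (b) statements are the instances `𝔅 := bondsDet 𝐁`.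

Cell `pub-ymgap` (HUMAN RULINGS D-0062 ∕ D-0149), seat `pub-ymgap-dag-n12-d` g32 (R134 N12 [B15] s2; the (ii) Theorems-side re-key of N12's road at print's [II] (2.3) datum — director-ym №338 ∕
№343 (E1)(iii-b), FLAG №16 ∕ ruling (α); dag-n12-c DESIGN memo a793b2ebc0b803bf (ii); `N12-ROAD-TWIN-ORDER-2026-08-30.md`).  Count-neutral helper of K1⁹ `stmt-QuantumFields-27364`,
`--kind proof --supports … --as helper`.  THEOREMS ONLY (0 `def`, 0 `instance`, 0 `sorry`).

HONEST FRAMING (director-ym №338 (5)).  PURELY ADDITIVE: the parent stays landed and true on its own text; nothing in it is edited; no displayed premise of any consumer is deleted or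
weakened; every hypothesis of the parent stays a hypothesis.  Nothing of Bałaban's analysis asserted; N12 NOT discharged; K0⁷ ∕ K1⁹ NOT closed; counts unmoved (typed 28∕28 · discharged
8∕27, A 8∕28; K 1∕4); one finite 𝕋⁴ programme at fixed ε — R4 closes the conditional rung `BalabanLadder.UV` only; NOT the Yang–Mills mass gap (Clay); nothing continuum ∕ ℝ⁴ ∕ OS.

PARENT's DOCSTRING (the mathematics and the citations; read the site-level `𝐁` as the bond datum `𝔅`):
# BalabanUVNodes ∕ N12 — THE FEDERBUSH FIBRE LETTER IN CHART CURRENCY: from «`DΦ♭(0) w′ = y`» (`Φ♭ = msChart F N K k 𝐁 (M˙1) 1`, n07-w2's canonical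
# multi-scale chart at the flat configuration) to the reproduction of the slice datum on the region, hence the `hm` binder of the near-flat one-sided (1.7)
# skeleton in the EXACT shape `∀ w′, L♭ w′ = y → m ≤ B♭ w′ w′` with `L♭ := fderiv ℝ Φ♭ 0`

Cell `pub-ymgap` (HUMAN RULINGS D-0062 ∕ D-0149), width seat `pub-ymgap-dag-n12-w4` g2 (U2c lane; sequel of this seat's `…N12NearFlatFederbushFibre`); the dictionary step the
prequel left to «the consumer» — typed here so that the skeleton's binder is met verbatim.  Key K1⁷ `stmt-QuantumFields-20542`, `--kind proof --supports … --as helper`;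
count-neutral; THEOREMS ONLY (0 `def`, 0 `sorry`, 0 `instance`).  CONSUMED BY NAME, nothing restated: dag-n10-w1's (J-b) B `N12FlatChartDerivIterLin.fderiv_msChart_one_apply_eq_iterLin`
∕ `iterLin_mem_lieSU` (p594415), n07-w2's `Node00.MultiScaleFibreChart` letters (`msChart`, `constrEnum`, `coe_suProj_of_mem`), this seat's
`N12NearFlatFederbushFibre.gamma0_circ_le_flatHessian_of_reproduce` (INTENT-7).

THE PRINT.  [Balaban1985Variational] (44)–(48) p. 285 (the linearised multi-scale constraint and «L^jηQ_jHB = B on Λ_j» (45)); [Balaban1988Convergent] (2.10)–(2.12) p. 256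
(the determining set `𝐁` and its constrained bonds); [Balaban1989LargeFieldII] (1.7) p. 358.

CONTENTS.
§1 ★ `iterLin_eq_of_fderiv_msChart_one_eq` — if `DΦ♭(0) w′ = y` then at every level-`k` constrained bond `b` of `𝐁` the k-fold linearised average of `w′` IS the datum:
   `(Q^{(k)}↑w′)(b) = ↑(y_{(k,b)})` (B's componentwise identity at the index of `(k, b)`, `π = id` on `𝔰𝔲(N)`).
§2 ★★ `reproduce_of_fderiv_msChart_one_eq` — the prequel's antecedent `hrep` on a region `S_k` whose `(e₀, e_ν)`-plaquette bonds are level-`k` constrained bonds of `𝐁`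
   carrying the datum values `φ(ιA X b)`; ★★★ `hm_federbush_of_fderiv_msChart_one_eq` — the skeleton's binder VERBATIM:
   `∀ w′, fderiv ℝ Φ♭ 0 w′ = y → ((L^d)^k∕(L²L²)^k)·circ(X) ≤ D²(A∘expChart 1)(0)(w′,w′)`.

HONEST FRAMING.  Bookkeeping by name; the two geometric dictionary hypotheses (the region's plaquette bonds are constrained at level `k`; the datum velocity `y` carries
`φ(ιA X)` there) are DISPLAYED — at the record they are the endpoint's window-inside-`Z` geometry (`hZ`) and the definition of the datum map; nothing of Bałaban's
asserted; N12 NOT discharged; K1⁷ NOT closed; count-neutral (typed 28∕28 · discharged 5∕27 unmoved); one finite 𝕋⁴ programme at fixed ε — R4 closes the conditional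
rung `BalabanLadder.UV` only; the YM mass gap (Clay) is NOT proved by any of this.  No `sorry`, no `def`, no `instance`, no `notation`.
-/

noncomputable section

open scoped BigOperators Matrix.Norms.L2Operator
open Finset

namespace Summit.QuantumFields.YangMills.BalabanUVNodes.N12NearFlatFederbushFibreChartB

open Literature.MathematicalPhysics.QuantumFieldTheory.Balaban1983to89.B15DeterminingSetsB

open Literature.MathematicalPhysics.QuantumFieldTheory.Balaban1983to89
open Literature.MathematicalPhysics.QuantumLattice (quatMatrix)
open T4Continuum (T4Family)
open T4HaarSU2ExpChart (imQuat)
open T4AdjointCovarianceUnitary (lieSU)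
open B15DeterminingSets GaugeField
open B15Prop1SliceCoordinates (GaugeSlice ιA)
open T4AxialGaugeSmallField (castSite)
open B6TreeGaugePoincare (curl)
open B16Eq18Proof (box)
open LatticeFieldCalculus (runSite)
open BlockAveragingEMLLinearised (linAvg)
open Node00
open Summit.QuantumFields.YangMills.BalabanUVNodes.N12FlatChartDerivIterLin (iterLin_mem_lieSU)
open Summit.QuantumFields.YangMills.BalabanUVNodes.N12FlatChartDerivIterLinB (fderiv_msChart_one_apply_eq_iterLin)
open Summit.QuantumFields.YangMills.BalabanUVNodes.N12NearFlatFederbushFibre (gamma0_circ_le_flatHessian_of_reproduce)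

section
variable {F : T4Family} {N : ℕ} [NeZero N] {K k : ℕ}

/-- ★ **THE DATUM IS REPRODUCED AT EVERY LEVEL-`k` CONSTRAINED BOND**: if `DΦ♭(0) w′ = y` for the flat multi-scale chart `Φ♭ = msChartB F N K k 𝐁 (M˙1) 1`, then for every
bond `b` of level `k` meeting `Γ_k = 𝐁 k` the k-fold linearised average of `w′` at `b` equals the datum component at the index of `(k, b)`, as matrices (B's
`fderiv_msChart_one_apply_eq_iterLin` at that index; `π` is the identity on the `𝔰𝔲(N)`-valued `Q^{(k)}↑w′`). [cite: Balaban1985Variational, (45) p.285; Balaban1988Convergent, (2.10) p.256] -/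
theorem iterLin_eq_of_fderiv_msChart_one_eq
    (Q : (i : ℕ) → (PBond (F.P K) 0 → Matrix (Fin N) (Fin N) ℂ) → PBond (F.P K) i → Matrix (Fin N) (Fin N) ℂ)
    (hQ0 : ∀ Y, Q 0 Y = Y) (hQs : ∀ (i : ℕ) (Y : PBond (F.P K) 0 → Matrix (Fin N) (Fin N) ℂ) (c : PBond (F.P K) (i + 1)), Q (i + 1) Y c = linAvg (Q i Y) c)
    (𝔅 : BDetSet (F.P K)) (w' : PBond (F.P K) 0 → lieSU (Fin N)) {y : Fin (constrCardB 𝔅 k) → lieSU (Fin N)}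
    (hD : fderiv ℝ (msChartB F N K k 𝔅 (avgFamily (avOfRecord F N K) (1 : GaugeField (F.P K) 0 (SU N))) (1 : GaugeField (F.P K) 0 (SU N))) 0 w' = y)
    (b : PBond (F.P K) k) (hb : b ∈ (𝔅 k)) :
    Q k (fun c => (w' c : Matrix (Fin N) (Fin N) ℂ)) b = ((y (constrEnumB 𝔅 k ⟨Fin.last k, ⟨b, hb⟩⟩) : lieSU (Fin N)) : Matrix (Fin N) (Fin N) ℂ) := by
  set i : Fin (constrCardB 𝔅 k) := constrEnumB 𝔅 k ⟨Fin.last k, ⟨b, hb⟩⟩ with hi_def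
  have hi : (constrEnumB 𝔅 k).symm i = ⟨Fin.last k, ⟨b, hb⟩⟩ := Equiv.symm_apply_apply _ _
  have h := fderiv_msChart_one_apply_eq_iterLin Q hQ0 hQs 𝔅 w' i
  -- transport the index `(j, c) = e.symm i` to `(k, b)` along `hi` (dependent pair: by substitution)
  have hgen : ∀ x : ConstrSetB 𝔅 k, x = ⟨Fin.last k, ⟨b, hb⟩⟩ →
      suProj N (Q ((x.1 : ℕ)) (fun c => (w' c : Matrix (Fin N) (Fin N) ℂ)) x.2.1) = suProj N (Q k (fun c => (w' c : Matrix (Fin N) (Fin N) ℂ)) b) := by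
    rintro x rfl
    rfl
  have h' : fderiv ℝ (msChartB F N K k 𝔅 (avgFamily (avOfRecord F N K) (1 : GaugeField (F.P K) 0 (SU N))) (1 : GaugeField (F.P K) 0 (SU N))) 0 w' i
      = suProj N (Q k (fun c => (w' c : Matrix (Fin N) (Fin N) ℂ)) b) := h.trans (hgen _ hi)
  rw [hD] at h'
  have hmem : Q k (fun c => (w' c : Matrix (Fin N) (Fin N) ℂ)) b ∈ lieSU (Fin N) := iterLin_mem_lieSU Q hQ0 hQs (fun c => (w' c).2) k b
  rw [h', coe_suProj_of_mem hmem]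

end

end Summit.QuantumFields.YangMills.BalabanUVNodes.N12NearFlatFederbushFibreChartB

end
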